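import Literature.Algebra.Homology.ContCohomologyInflation
import Literature.AnabelianGeometry.AbsoluteAnabelian.AbsCuspCohomology
import HarnessLib

/-!
# [AbsCusp] Prop. 2.1 (i) DISCHARGED: the inflation maps
# `H¹(Π^{c-cn}_{U_S}, M_X) ⥲ H¹(Π^{c-ab}_{U_S}, M_X) ⥲ H¹(Π_{U_S}, M_X)` are isomorphisms

S. Mochizuki, *Absolute anabelian cuspidalizations of proper hyperbolic curves*, J. Math. Kyoto
Univ. 47 (2007), Prop. 2.1 (i) p. 35 of the held copy (`paper:doi-10-1215-kjm-1250281022`):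
"The natural surjections induce isomorphisms
`H¹(Π^{c-cn}_{U_S}, M_X) ⥲ H¹(Π^{c-ab}_{U_S}, M_X) ⥲ H¹(Π_{U_S}, M_X)`".  Typed by this seat
(abc-iut-L4-t16, p407057 `AbsCuspCohomology.lean`) as `AbsCusp.Prop_2_1_i r q hI` over
abc-iut-L4-t1's group-theoretic cyclotome `M_X = geomCyclotome q` (`CuspidalCyclotome.lean`) and
Mathlib's `continuousCohomology`; cited by [AbsTopIII] Cor. 1.10 (iii)(g) p. 43 (plan/L4/LC1-CHAIN
M3).  PROVED HERE for ALL presentations `r : Π_{U_S} → Π_{U_x}`, `q : Π_{U_x} → Π_X` with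
`I := Ker(Π_{U_S} → Π_X) ≤ Δ_{U_S}` (`prop_2_1_i_holds`), hence the (M)-form `Prop_2_1_i_model M`
for every `CurveModel` (`prop_2_1_i_model_holds`): net named-fact debt −1 (the model form).

PROOF (ours; print: "Assertion (i) follows immediately from the definitions", p. 36).  By the
generic degree-one inflation theorem `ContinuousCohomology.isIso_map_one_of_crossedHomsKillKer`
(`Literature/Algebra/Homology/ContCohomologyInflation.lean`: for a quotient map `φ : H ↠ G` of
compact groups, inflation is an isomorphism on `H¹` as soon as every continuous crossed
homomorphism `H → M` kills `Ker φ`) it suffices to show: every continuous crossed homomorphism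
`f : Π_{U_S} → M_X` (for t1's action `geomCyclotomeRep r q`, conjugation inside
`Π_{U_x}/[N, Δ_{U_x}]⁻`) vanishes on `[I ∩ Δ_{U_S}, Δ_{U_S}]⁻` (⊇ `[I, I]⁻`).  Indeed `Δ_{U_S}` acts
TRIVIALLY on `M_X` (`geomCyclotomeRep_apply_of_mem_geom`: `r(Δ_{U_S}) ⊆ Δ_{U_x}` and `[Δ_{U_x}, N]`
dies in the cuspidally central quotient — this is the point of [AbsCusp] Def. 1.1 (i) "cuspidally
central"), so `f|_{Δ_{U_S}}` is a continuous homomorphism to an abelian group and kills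
commutators; the zero set of a continuous crossed homomorphism is a closed subgroup
(`crossedHom_eq_zero_of_mem_closure_commutator`), so `f` kills the closure.  The two quotient maps `Π_{U_S} ↠ Π^{c-ab}_{U_S}`,
`Π^{c-ab}_{U_S} ↠ Π^{c-cn}_{U_S}` are quotient maps of compact Hausdorff groups.
HONEST FRAMING: a refereed, undisputed result; no side taken on [IUTchIII] Cor. 3.12.
-/

noncomputable section

open CategoryTheory Topology
open scoped Pointwise IsMulCommutative

namespace Literature.AnabelianGeometry.AbsoluteAnabelian

namespace AbsCusp

open AbsTopIII ContinuousCohomology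

universe u

variable {E' E F : FundamentalExtension.{u}} (r : E' ⟶ E) (q : E ⟶ F)

/-! ### `Δ_{U_S}` acts trivially on `M_X` -/

/-- Conjugation by (the image of) an element of `Δ_{U_x}` is trivial on `M_X ⊆ Π_{U_x}/[N, Δ_{U_x}]⁻`:
`[Δ_{U_x}, N] ⊆ [N, Δ_{U_x}]⁻`. [cite: MochizukiAbsCusp2007, Def 1.1 (i) p.10] -/
theorem conjNormal_mk_eq_of_mem_geom {c : E.arith} (hc : c ∈ E.geom) (w : geomCyclotome q) :
    MulAut.conjNormal (QuotientGroup.mk' (AbsTopIII.cuspidallyCentralModulus q) c :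
      CuspidallyCentralQuotient q) w = w := by
  obtain ⟨y, hy⟩ := w
  obtain ⟨x, hx, rfl⟩ := Subgroup.mem_map.mp hy
  apply Subtype.ext
  rw [MulAut.conjNormal_apply]
  change QuotientGroup.mk' _ c * QuotientGroup.mk' _ x * (QuotientGroup.mk' _ c)⁻¹ =
    QuotientGroup.mk' _ x
  rw [← map_inv, ← map_mul, ← map_mul, QuotientGroup.mk'_apply, QuotientGroup.mk'_apply,
    QuotientGroup.eq]
  have hmem := Subgroup.commutator_mem_commutator hc (inv_mem hx)
  rw [Subgroup.commutator_comm, commutatorElement_def, inv_inv] at hmem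
  have h : (c * x * c⁻¹)⁻¹ * x = c * x⁻¹ * c⁻¹ * x := by
    simp only [mul_inv_rev, inv_inv, mul_assoc]
  rw [h]
  exact Subgroup.le_topologicalClosure _ hmem

/-- `Δ_{U_S}` acts trivially on the `Π_{U_S}`-module `M_X` (`geomCyclotomeRep r q`): `r` maps
`Δ_{U_S}` into `Δ_{U_x}`. [cite: MochizukiAbsCusp2007, Prop 2.1 (i) p.35] -/
theorem geomCyclotomeRep_apply_of_mem_geom {a : E'.arith} (ha : a ∈ E'.geom)
    (v : Additive (geomCyclotome q)) : geomCyclotomeRep r q a v = v := by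
  change conjCLM (geomCyclotome q) (toCuspidallyCentralQuotient r q a) v = v
  rw [conjCLM_apply]
  change Additive.ofMul (MulAut.conjNormal
    (QuotientGroup.mk' (AbsTopIII.cuspidallyCentralModulus q) (r.arith a)) (Additive.toMul v)) = v
  rw [conjNormal_mk_eq_of_mem_geom q (r.mapsTo_geom ha)]
  rfl

/-! ### A continuous crossed homomorphism kills the closed commutator of a trivially-acting subgroup -/

section CrossedHomKer

variable {P : Type u} [Group P] [TopologicalSpace P] [IsTopologicalGroup P] {V : Type u}
  [AddCommGroup V] [Module ℤ V] [TopologicalSpace V] [IsTopologicalAddGroup V] [T1Space V]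
  (ρ : ContRepresentation ℤ P V)

/-- Let `f : P → V` be a continuous crossed homomorphism (`f (a b) = f a + a • f b`) into a Hausdorff
module and `D ≤ P` a subgroup acting trivially on `V`.  Then `f` vanishes on the closure of
`[D', D]` for every `D' ≤ D`: the zero set of `f` is a closed subgroup (`f (a b) = f a + a • f b`,
`f 1 = 0`), and on `D` the map `f` is a homomorphism into an abelian group, so it kills commutators.
[cite: SerreGaloisCohomology1997, I §2.3] -/
theorem crossedHom_eq_zero_of_mem_closure_commutator (f : C(P, V))
    (hf : ∀ a b, f (a * b) = f a + ρ a (f b)) {D D' : Subgroup P} (hD'D : D' ≤ D)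
    (hD : ∀ d ∈ D, ∀ v, ρ d v = v) {m : P} (hm : m ∈ (⁅D', D⁆).topologicalClosure) :
    f m = 0 := by
  have h1 : f 1 = 0 := by
    have h := hf 1 1
    rw [mul_one, map_one ρ, one_apply_eq_self] at h
    simpa using h
  -- the zero set of `f` is a subgroup
  let K : Subgroup P :=
    { carrier := {m | f m = 0}
      one_mem' := h1
      mul_mem' := fun {a b} (ha : f a = 0) (hb : f b = 0) => by
        change f (a * b) = 0
        rw [hf, ha, hb, map_zero, add_zero]
      inv_mem' := fun {a} (ha : f a = 0) => by
        change f a⁻¹ = 0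
        have h := hf a⁻¹ a
        rw [inv_mul_cancel, h1, ha, map_zero, add_zero] at h
        exact h.symm }
  -- … which is closed
  have hK : IsClosed (K : Set P) := isClosed_singleton.preimage f.continuous
  -- on `D`, `f` is a homomorphism
  have hadd : ∀ x ∈ D, ∀ y, f (x * y) = f x + f y := fun x hx y => by rw [hf, hD x hx]
  have hinv : ∀ x ∈ D, f x⁻¹ = -f x := fun x hx => by
    have h := hadd x hx x⁻¹
    rw [mul_inv_cancel, h1] at h
    exact (neg_eq_of_add_eq_zero_right h.symm).symm
  have hle : (⁅D', D⁆).topologicalClosure ≤ K := by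
    refine Subgroup.topologicalClosure_minimal _ ?_ hK
    rw [Subgroup.commutator_le]
    intro a ha b hb
    have ha' : a ∈ D := hD'D ha
    rw [commutatorElement_def]
    change f (a * b * a⁻¹ * b⁻¹) = 0
    rw [hadd _ (D.mul_mem (D.mul_mem ha' hb) (D.inv_mem ha')), hadd _ (D.mul_mem ha' hb),
      hadd _ ha', hinv _ ha', hinv _ hb]
    abel
  exact hle hm

end CrossedHomKer

/-! ### Crossed homomorphisms `Π_{U_S} → M_X` kill `[I ∩ Δ_{U_S}, Δ_{U_S}]⁻` -/

/-- `M_X` is Hausdorff (a subgroup of the quotient of `Π_{U_x}` by the CLOSED subgroup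
`[N, Δ_{U_x}]⁻`). [cite: MochizukiAbsCusp2007, Prop 2.1 (i) p.35] -/
theorem t1Space_geomCyclotome : T1Space (Additive (geomCyclotome q)) := by
  haveI : IsClosed ((AbsTopIII.cuspidallyCentralModulus q : Subgroup E.arith) : Set E.arith) :=
    Subgroup.isClosed_topologicalClosure _
  change T1Space (geomCyclotome q)
  infer_instance

/-- CORE LEMMA.  Every continuous crossed homomorphism `f : Π_{U_S} → M_X` (for the action
`geomCyclotomeRep r q`) vanishes on `[I ∩ Δ_{U_S}, Δ_{U_S}]⁻ = AbsTopIII.cuspidallyCentralModulus (r ≫ q)`: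
`Δ_{U_S}` acts trivially, so `f|_{Δ_{U_S}}` is a continuous homomorphism into an abelian Hausdorff
group. [cite: MochizukiAbsCusp2007, Prop 2.1 (i) p.35] -/
theorem crossedHom_eq_zero_of_mem_ccnModulus (f : C(E'.arith, Additive (geomCyclotome q)))
    (hf : ∀ a b, f (a * b) = f a + geomCyclotomeRep r q a (f b)) {m : E'.arith}
    (hm : m ∈ AbsTopIII.cuspidallyCentralModulus (r ≫ q)) : f m = 0 :=
  haveI := t1Space_geomCyclotome q
  haveI : IsClosed ((AbsTopIII.cuspidallyCentralModulus q : Subgroup E.arith) : Set E.arith) :=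
    Subgroup.isClosed_topologicalClosure _
  crossedHom_eq_zero_of_mem_closure_commutator (geomCyclotomeRep r q) f hf
    (D' := cuspidalKernel (r ≫ q)) (D := E'.geom) inf_le_right
    (fun _ hd v => geomCyclotomeRep_apply_of_mem_geom r q hd v) hm

/-! ### The hypotheses of the inflation theorem for `Π_{U_S} ↠ Π^{c-ab}_{U_S} ↠ Π^{c-cn}_{U_S}` -/

/-- `Π^{c-ab}_{U_S}` is compact. [cite: MochizukiAbsCusp2007, Prop 2.1 p.35] -/
theorem compactSpace_maxCuspAbelianOver : CompactSpace (MaxCuspAbelianOver r q) :=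
  Quotient.compactSpace

/-- `Π^{c-ab}_{U_S}` is Hausdorff (`[I, I]⁻` is closed). [cite: MochizukiAbsCusp2007, Prop 2.1 p.35] -/
theorem t2Space_maxCuspAbelianOver : T2Space (MaxCuspAbelianOver r q) := by
  haveI : IsClosed ((cuspAbelianModulus r q : Subgroup E'.arith) : Set E'.arith) :=
    Subgroup.isClosed_topologicalClosure _
  infer_instance

/-- `Π^{c-cn}_{U_S}` is Hausdorff (`[I ∩ Δ, Δ]⁻` is closed). [cite: MochizukiAbsCusp2007, Prop 2.1 p.35] -/
theorem t2Space_cuspidallyCentralQuotient : T2Space (CuspidallyCentralQuotient (r ≫ q)) := by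
  haveI : IsClosed ((AbsTopIII.cuspidallyCentralModulus (r ≫ q) : Subgroup E'.arith) :
      Set E'.arith) :=
    Subgroup.isClosed_topologicalClosure _
  infer_instance

/-- `Π_{U_S} ↠ Π^{c-ab}_{U_S}` is a quotient map. [cite: MochizukiAbsCusp2007, Prop 2.1 p.35] -/
theorem isQuotientMap_piAb : IsQuotientMap (piAb r q) :=
  QuotientGroup.isQuotientMap_mk (cuspAbelianModulus r q)

/-- `piCn ∘ piAb` is the quotient map `Π_{U_S} ↠ Π^{c-cn}_{U_S}`. [cite: MochizukiAbsCusp2007, Prop 2.1 p.35] -/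
theorem piCn_piAb (hI : cuspidalOver r q ≤ E'.geom) (m : E'.arith) :
    piCn r q hI (piAb r q m) = (QuotientGroup.mk m : CuspidallyCentralQuotient (r ≫ q)) := rfl

/-- `Π^{c-ab}_{U_S} ↠ Π^{c-cn}_{U_S}` is a quotient map. [cite: MochizukiAbsCusp2007, Prop 2.1 p.35] -/
theorem isQuotientMap_piCn (hI : cuspidalOver r q ≤ E'.geom) : IsQuotientMap (piCn r q hI) := by
  have h : IsQuotientMap (piCn r q hI ∘ piAb r q) :=
    QuotientGroup.isQuotientMap_mk (AbsTopIII.cuspidallyCentralModulus (r ≫ q))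
  exact IsQuotientMap.of_comp (piAb r q).continuous (piCn r q hI).continuous h

/-- Hypothesis `CrossedHomsKillKer` for `Π_{U_S} ↠ Π^{c-ab}_{U_S}`: crossed homomorphisms on `Π_{U_S}`
kill `[I, I]⁻`. [cite: MochizukiAbsCusp2007, Prop 2.1 (i) p.35] -/
theorem crossedHomsKillKer_piAb (hI : cuspidalOver r q ≤ E'.geom) :
    CrossedHomsKillKer (piAb r q)
      (TopRep.res (piCn r q hI : MaxCuspAbelianOver r q →* CuspidallyCentralQuotient (r ≫ q))
        (ccnTopRep r q)) := by
  intro f hf n hn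
  have hn' : n ∈ cuspAbelianModulus r q := by
    rwa [← QuotientGroup.eq_one_iff]
  exact crossedHom_eq_zero_of_mem_ccnModulus r q f hf (cuspAbelianModulus_le_ccnModulus r q hI hn')

/-- Hypothesis `CrossedHomsKillKer` for `Π^{c-ab}_{U_S} ↠ Π^{c-cn}_{U_S}`: pull the crossed
homomorphism back to `Π_{U_S}`, where it kills `[I ∩ Δ, Δ]⁻`.
[cite: MochizukiAbsCusp2007, Prop 2.1 (i) p.35] -/
theorem crossedHomsKillKer_piCn (hI : cuspidalOver r q ≤ E'.geom) :
    CrossedHomsKillKer (piCn r q hI) (ccnTopRep r q) := by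
  intro f hf n hn
  obtain ⟨m, rfl⟩ := QuotientGroup.mk_surjective n
  have hf' : ∀ a b : E'.arith, (f.comp (piAb r q).toContinuousMap) (a * b) =
      (f.comp (piAb r q).toContinuousMap) a +
        geomCyclotomeRep r q a ((f.comp (piAb r q).toContinuousMap) b) := by
    intro a b
    simp only [ContinuousMap.comp_apply, ContinuousMonoidHom.toContinuousMap]
    change f (piAb r q (a * b)) = f (piAb r q a) + geomCyclotomeRep r q a (f (piAb r q b))
    rw [map_mul, hf]
    rfl
  have hm : m ∈ AbsTopIII.cuspidallyCentralModulus (r ≫ q) := by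
    rw [← QuotientGroup.eq_one_iff]
    exact hn
  exact crossedHom_eq_zero_of_mem_ccnModulus r q _ hf' hm

/-! ### Proposition 2.1 (i) -/

/-- **[AbsCusp] Prop. 2.1 (i) PROVED** for every presentation `U_S ⊆ U_x ⊆ X` with `I ≤ Δ_{U_S}`:
both inflation maps `H¹(Π^{c-cn}_{U_S}, M_X) → H¹(Π^{c-ab}_{U_S}, M_X) → H¹(Π_{U_S}, M_X)` are
isomorphisms (in `TopModuleCat ℤ`). [cite: MochizukiAbsCusp2007, Prop 2.1 (i) p.35] -/
theorem prop_2_1_i_holds (hI : cuspidalOver r q ≤ E'.geom) : Prop_2_1_i r q hI := by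
  haveI := compactSpace_maxCuspAbelianOver r q
  haveI := t2Space_maxCuspAbelianOver r q
  haveI := t2Space_cuspidallyCentralQuotient r q
  exact ⟨isIso_map_one_of_crossedHomsKillKer (isQuotientMap_piCn r q hI)
      (crossedHomsKillKer_piCn r q hI),
    isIso_map_one_of_crossedHomsKillKer (isQuotientMap_piAb r q) (crossedHomsKillKer_piAb r q hI)⟩

/-- **[AbsCusp] Prop. 2.1 (i), (M)-form, DISCHARGED** for every `CurveModel`.
[cite: MochizukiAbsCusp2007, Prop 2.1 (i) p.35] -/
theorem prop_2_1_i_model_holds (M : CurveModel.{u}) : Prop_2_1_i_model M :=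
  fun _ _ _ h₁ h₂ _ hI _ _ _ => prop_2_1_i_holds (M.res h₁) (M.res h₂) hI

end AbsCusp

end Literature.AnabelianGeometry.AbsoluteAnabelian
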